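import Literature.Probability.RandomPlanarGeometry.LoewnerImageChain
import HarnessLib

/-!
# The conformal image of a Loewner chain: swallowing times correspond under the capacity clock

Sequel of `LoewnerImageChain` ([LSW] 2003 §5: the image maps `g̃_t = h_t ∘ g_t ∘ Φ_A⁻¹` form, in
capacity time, the Loewner chain of `W̃ ∘ τ`). Here we identify the LIFETIMES of the image flow: a
point `z ∈ ℍ ∖ A` swallowed by the chain of `W` at a time `b = T_z` before the hulls reach `A` has
its image `g̃_0(ζ)` swallowed by the chain of `W̃ ∘ τ` exactly at the capacity time `σ(b)`
(`swallowingTime_imageDriverC_eq`), and consequently **the hulls of the image chain are the images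
of the hulls**, `Loewner.hull (W̃ ∘ τ) q = E_A(K_{τ q})` for `q < σ β` (`hull_imageDriverC_eq`,
`W 0 = 0`; [LSW]: "`K̃_t = Φ_A(K_t)`"). The identification of the generating curve
(`E_A ∘ γ ∘ τ`) is left to the sequel.

Ingredients: restriction of horizons (the inverse clocks, image drivers and image flows of two
nested alive horizons agree on the smaller range: `imageClockInv_eq_of_le`,
`isSolution_imageFlowC_of_le`); the lower bound `σ(β') ≤ T̂` for every `β' < b` and the continuity
of `σ`; for the upper bound, a solution of the image equation living past `σ(b)` stays `δ`-away
from `W̃ ∘ τ` on `[0, σ b]` (`IsSolution.exists_le_norm_sub`), i.e. `|E_{B_t}(g_t z − W_t)| ≥ δ` for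
`t < b`, while `|E_{B_t}(y)| ≤ 2|y|` near `0` uniformly in `t ≤ b` (`norm_starMap_le_two_mul`, the
hulls `B_t` keeping a uniform distance from `0` on the compact alive interval `[0, b]`), which
contradicts the extension criterion `exists_norm_map_sub_lt_of_swallowingTime_eq` (the flow of a
swallowed point comes arbitrarily close to the driver). No named fact, no definition.

## References

* [LSW] 2003, §5 (g̃_t, T = T_A). [LawlerSchrammWerner2003Restriction]
* G. F. Lawler (2005), §4.1 (lifetime of the flow), §4.6.1 Prop. 4.41. [Lawler2005]
-/

noncomputable section

open Set Filter Metric Function MeasureTheory intervalIntegral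
open _root_.Complex _root_.Topology _root_.Real
open UpperHalfPlane (upperHalfPlaneSet)
open scoped NNReal

namespace Literature.Probability.RandomPlanarGeometry

namespace Loewner

variable {W : ℝ≥0 → ℝ} {A : Set ℂ}

/-! ### Nested horizons -/

section Nested

variable (hW : Continuous W) (hA : IsStarHull A) (hne : A.Nonempty) {β β' : ℝ≥0}
  (hβ : Disjoint (closedHull W β) A) (hβ'β : β' ≤ β)
include hW hA hne hβ hβ'β

/-- **The inverse clocks of nested alive horizons agree on the smaller range.** [folklore] -/
theorem imageClockInv_eq_of_le {q : ℝ} (hq : q ∈ Icc (0 : ℝ) (imageClock W A β')) :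
    imageClockInv W A β' q = imageClockInv W A β q := by
  have hβ' : Disjoint (closedHull W β') A := alive_mono hβ'β hβ
  obtain ⟨ht', hσ'⟩ := imageClockInv_spec hW hA hne hβ' hq
  have hmono := strictMonoOn_imageClock hW hA hne hβ
  have hq' : q ∈ Icc (0 : ℝ) (imageClock W A β) :=
    ⟨hq.1, hq.2.trans (hmono.monotoneOn ⟨β'.coe_nonneg, NNReal.coe_le_coe.2 hβ'β⟩ ⟨β.coe_nonneg, le_rfl⟩
      (NNReal.coe_le_coe.2 hβ'β))⟩
  obtain ⟨ht, hσ⟩ := imageClockInv_spec hW hA hne hβ hq'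
  exact hmono.injOn ⟨ht'.1, ht'.2.trans (NNReal.coe_le_coe.2 hβ'β)⟩ ht (hσ'.trans hσ.symm)

/-- The image drivers of nested horizons agree in capacity times `≤ σ β'`. [folklore] -/
theorem imageDriverC_eq_of_le {q : ℝ} (hq : q ∈ Icc (0 : ℝ) (imageClock W A β')) :
    imageDriverC W A β' q.toNNReal = imageDriverC W A β q.toNNReal := by
  have hmono := strictMonoOn_imageClock hW hA hne hβ
  have hq' : q ∈ Icc (0 : ℝ) (imageClock W A β) :=
    ⟨hq.1, hq.2.trans (hmono.monotoneOn ⟨β'.coe_nonneg, NNReal.coe_le_coe.2 hβ'β⟩ ⟨β.coe_nonneg, le_rfl⟩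
      (NNReal.coe_le_coe.2 hβ'β))⟩
  rw [imageDriverC_toNNReal hq, imageDriverC_toNNReal hq', imageClockInv_eq_of_le hW hA hne hβ hβ'β hq]

variable {z : ℂ} (hzH : 0 < z.im) (hzA : z ∉ A) (hzβ' : (β' : WithTop ℝ≥0) < swallowingTime W z)
include hzH hzA hzβ'

/-- **The image flow of horizon `β'` solves the image equation of the larger horizon `β`** (the two
drivers agree on `[0, σ β']`). [folklore] -/
theorem isSolution_imageFlowC_of_le :
    IsSolution (imageDriverC W A β) (imageFlow W A 0 z) (imageFlowC W A β' z)
      ((imageClock W A β').toNNReal : WithTop ℝ≥0) := by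
  have hβ' : Disjoint (closedHull W β') A := alive_mono hβ'β hβ
  obtain ⟨h0, hcurve, hne0⟩ := isSolution_imageFlowC hW hA hne hβ' hzH hzA hzβ'
  have hS0 : 0 ≤ imageClock W A β' := (imageClock_mem hW hA hne hβ' ⟨β'.coe_nonneg, le_rfl⟩).1
  have hmem : ∀ {t : ℝ}, 0 ≤ t → ((t.toNNReal : WithTop ℝ≥0) < ((imageClock W A β').toNNReal : WithTop ℝ≥0)) →
      t ∈ Icc (0 : ℝ) (imageClock W A β') := fun ht0 ht ↦ by
    have := WithTop.coe_lt_coe.1 ht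
    rw [← NNReal.coe_lt_coe, Real.coe_toNNReal _ ht0, Real.coe_toNNReal _ hS0] at this
    exact ⟨ht0, this.le⟩
  refine ⟨h0, fun t ht ↦ ?_, fun t ht0 ht ↦ ?_⟩
  · have h := hcurve t ht
    rw [vectorField_apply] at h
    rw [vectorField_apply, ← imageDriverC_eq_of_le hW hA hne hβ hβ'β (hmem ht.1 ht.2)]
    exact h
  · rw [← imageDriverC_eq_of_le hW hA hne hβ hβ'β (hmem ht0 ht)]
    exact hne0 t ht0 ht

end Nested

/-! ### `|E_B(y)| ≤ 2|y|` near the origin -/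

/-- For a `*`-hull `B` off `B(0, 8ρ)` and `‖y‖ < 4ρ`: `‖E_B(y)‖ ≤ 2‖y‖` (`E_B(0) = 0`, `|E_B'| ≤ 2` on
`B(0, 4ρ)`). [folklore] -/
theorem norm_starMap_le_two_mul {B : Set ℂ} (hB : IsStarHull B) {ρ : ℝ} (hρ : 0 < ρ)
    (hBρ : Disjoint (ball (0 : ℂ) (8 * ρ)) B) {y : ℂ} (hy : ‖y‖ < 4 * ρ) : ‖starMap B y‖ ≤ 2 * ‖y‖ := by
  have hΦ := isRestrictionMap_starRMap hB
  obtain ⟨h1, -, -, -⟩ := norm_iteratedDeriv_hullExt_le hB hΦ hρ hBρ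
  have hE : DifferentiableOn ℂ (starMap B) (ball (0 : ℂ) (4 * ρ)) := differentiableOn_starMap hB hρ hBρ
  have := (convex_ball (0 : ℂ) (4 * ρ)).norm_image_sub_le_of_norm_deriv_le (f := starMap B) (C := 2)
    (fun w hw ↦ hE.differentiableAt (isOpen_ball.mem_nhds hw))
    (fun w hw ↦ by rw [starMap_eq hB]; exact h1 w hw) (mem_ball_self (by positivity)) (mem_ball_zero_iff.2 hy)
  rwa [starMap_zero hB, sub_zero, sub_zero] at this

/-! ### The swallowing time of the image point -/

section Lifetime

/-- `0 < b`: a point of `ℍ` flows for a positive time. [folklore] -/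
theorem swallowingTime_coe_pos (hW : Continuous W) {z : ℂ} (hzH : 0 < z.im) {b : ℝ≥0}
    (hb : swallowingTime W z = b) : 0 < b := by
  have hz0 : z ≠ W 0 := by
    intro h; rw [h, ofReal_im] at hzH; exact lt_irrefl _ hzH
  have := swallowingTime_pos_holds hW hz0
  rw [hb] at this
  exact_mod_cast this

variable (hW : Continuous W) (hA : IsStarHull A) (hne : A.Nonempty) {β : ℝ≥0} (hβ : Disjoint (closedHull W β) A)
  {z : ℂ} (hzH : 0 < z.im) (hzA : z ∉ A) {b : ℝ≥0} (hb : swallowingTime W z = b) (hbβ : b ≤ β)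
include hW hA hne hβ hzH hzA hb hbβ

/-- **Lower bound: `σ(b) ≤ T̂`** — the image flows of the horizons `β' < b` are solutions of the image
equation with lifetimes `σ(β') ↑ σ(b)`. [folklore] -/
theorem imageClock_le_swallowingTime_imageDriverC :
    ((imageClock W A b).toNNReal : WithTop ℝ≥0) ≤ swallowingTime (imageDriverC W A β) (imageFlow W A 0 z) := by
  set That := swallowingTime (imageDriverC W A β) (imageFlow W A 0 z) with hT
  have hbal : Disjoint (closedHull W b) A := alive_mono hbβ hβ
  have hb0 := swallowingTime_coe_pos hW hzH hb
  -- `σ β' ≤ T̂` for `β' < b`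
  have hstep : ∀ β' : ℝ≥0, β' < b → ((imageClock W A β').toNNReal : WithTop ℝ≥0) ≤ That := by
    intro β' hβ'
    have hzβ' : (β' : WithTop ℝ≥0) < swallowingTime W z := by rw [hb]; exact_mod_cast hβ'
    exact (isSolution_imageFlowC_of_le hW hA hne hβ (hβ'.le.trans hbβ) hzH hzA hzβ').le_swallowingTime
  -- pass to the limit `β' ↑ b` by continuity of `σ` on `[0, b]`
  induction hT' : That with
  | top => exact le_top
  | coe c =>
    rw [hT'] at hstep
    refine WithTop.coe_le_coe.2 ?_
    have hcont := continuousOn_imageClock hW hA hne hbal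
    have hσb : ContinuousWithinAt (imageClock W A) (Icc (0 : ℝ) b) b := hcont b ⟨b.coe_nonneg, le_rfl⟩
    -- `σ b = lim σ β'` along `β' → b⁻`; each `σ β' ≤ c`
    have hle : ∀ t ∈ Ico (0 : ℝ) b, imageClock W A t ≤ c := by
      intro t ht
      have h := hstep t.toNNReal (by rw [← NNReal.coe_lt_coe, Real.coe_toNNReal t ht.1]; exact ht.2)
      rw [Real.coe_toNNReal t ht.1] at h
      have := WithTop.coe_le_coe.1 h
      rwa [← NNReal.coe_le_coe, Real.coe_toNNReal _ ((imageClock_mem hW hA hne hbal ⟨ht.1, ht.2.le⟩).1)] at this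
    have hS0 : 0 ≤ imageClock W A b := (imageClock_mem hW hA hne hbal ⟨b.coe_nonneg, le_rfl⟩).1
    rw [← NNReal.coe_le_coe, Real.coe_toNNReal _ hS0]
    haveI hne' : (𝓝[Ico (0 : ℝ) b] (b : ℝ)).NeBot := by
      refine mem_closure_iff_nhdsWithin_neBot.1 ?_
      rw [closure_Ico (by positivity : (0 : ℝ) ≠ b)]
      exact ⟨b.coe_nonneg, le_rfl⟩
    exact le_of_tendsto (hσb.tendsto.mono_left (nhdsWithin_mono _ Ico_subset_Icc_self))
      (eventually_nhdsWithin_of_forall hle)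

/-- **Upper bound: `T̂ ≤ σ(b)`.** If the image point survived past `σ(b)`, its flow would stay `δ`-away
from `W̃ ∘ τ` on `[0, σ b]`, forcing `|g_t z − W_t| ≥ min(4ρ, δ/2)` for all `t < b` — impossible for a
point swallowed at `b`. [cite: Lawler2005, Ch. 4 §4.1 (extension of the flow)] -/
theorem swallowingTime_imageDriverC_le_imageClock :
    swallowingTime (imageDriverC W A β) (imageFlow W A 0 z) ≤ ((imageClock W A b).toNNReal : WithTop ℝ≥0) := by
  set Wc := imageDriverC W A β with hWc
  set ζ := imageFlow W A 0 z with hζ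
  have hbal : Disjoint (closedHull W b) A := alive_mono hbβ hβ
  have hb0 := swallowingTime_coe_pos hW hzH hb
  have hWcc : Continuous Wc := continuous_imageDriverC hW hA hne hβ
  have hS0 : 0 ≤ imageClock W A b := (imageClock_mem hW hA hne hbal ⟨b.coe_nonneg, le_rfl⟩).1
  by_contra hgt
  rw [not_le] at hgt
  -- the maximal image solution from `ζ`
  have hz0 : (0 : WithTop ℝ≥0) < swallowingTime W z := by rw [hb]; exact_mod_cast hb0
  have hζne : ζ ≠ Wc 0 := by
    intro h
    have := im_imageFlow_sub_imageDriver_pos hW hA (alive_mono (show (0 : ℝ≥0) ≤ β from bot_le) hβ) hzH hzA hz0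
    have h' : Wc 0 = imageDriver W A 0 := by
      rw [hWc, ← Real.toNNReal_zero, imageDriverC_toNNReal ⟨le_rfl, (imageClock_mem hW hA hne hβ ⟨β.coe_nonneg, le_rfl⟩).1⟩,
        imageClockInv_zero hW hA hne hβ, Real.toNNReal_zero]
    rw [hζ] at h
    rw [h, h', sub_self, zero_im] at this
    exact lt_irrefl _ this
  obtain ⟨ĝ, hĝ⟩ := exists_isSolution_swallowingTime_holds hWcc hζne
  -- `δ`-separation on `[0, σ b]`
  obtain ⟨δ, hδ, hsep⟩ := hĝ.exists_le_norm_sub hWcc hS0 hgt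
  -- uniform distance of the hulls `B_t`, `t ≤ b`, from `0`
  have hmc : ContinuousOn (fun t : ℝ ↦ infDist 0 (slidHull W A t.toNNReal)) (Icc (0 : ℝ) b) := fun t ht ↦
    continuousWithinAt_comp_toNNReal hbal t (continuousWithinAt_infDist_slidHull hW hA hne
      (alive_mono (by rw [← NNReal.coe_le_coe, Real.coe_toNNReal _ ht.1]; exact ht.2) hbal))
  obtain ⟨t₀, ht₀, hmin⟩ := isCompact_Icc.exists_isMinOn (⟨0, le_rfl, b.coe_nonneg⟩ : (Icc (0 : ℝ) b).Nonempty) hmc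
  set m : ℝ := infDist 0 (slidHull W A t₀.toNNReal) with hm
  have hm0 : 0 < m := (infDist_zero_pos (isStarHull_slidHull_of_disjoint hW hA
    (alive_mono (by rw [← NNReal.coe_le_coe, Real.coe_toNNReal _ ht₀.1]; exact ht₀.2) hbal)) (hne.image _)).1
  set ρ : ℝ := m / 16 with hρ
  have hρ0 : 0 < ρ := by positivity
  have hBρ : ∀ t : ℝ≥0, t ≤ b → Disjoint (ball (0 : ℂ) (8 * ρ)) (slidHull W A t) := by
    intro t ht
    have hmt : m ≤ infDist 0 (slidHull W A t) := by
      have := hmin (show (t : ℝ) ∈ Icc (0 : ℝ) b from ⟨t.coe_nonneg, NNReal.coe_le_coe.2 ht⟩)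
      simpa [hm] using this
    refine Set.disjoint_left.2 fun w hw hwB ↦ ?_
    have h1 := infDist_le_dist_of_mem (x := (0 : ℂ)) hwB
    rw [mem_ball] at hw
    have : dist (0 : ℂ) w = dist w 0 := dist_comm _ _
    linarith
  -- for `t < b`: `|G_t z − W̃_t| ≥ δ`
  have hmonoβ := strictMonoOn_imageClock hW hA hne hβ
  have hfar : ∀ t : ℝ≥0, t < b → (δ : ℝ) ≤ ‖imageFlow W A t z - imageDriver W A t‖ := by
    intro t htb
    -- an intermediate horizon `β' ∈ (t, b)`
    set β' : ℝ≥0 := ⟨((t : ℝ) + b) / 2, by positivity⟩ with hβ'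
    have hβ'coe : (β' : ℝ) = ((t : ℝ) + b) / 2 := rfl
    have htb' : (t : ℝ) < b := NNReal.coe_lt_coe.2 htb
    have htβ' : t < β' := by rw [← NNReal.coe_lt_coe, hβ'coe]; linarith
    have hβ'b : β' < b := by rw [← NNReal.coe_lt_coe, hβ'coe]; linarith
    have hβ'β : β' ≤ β := hβ'b.le.trans hbβ
    have hβ'al : Disjoint (closedHull W β') A := alive_mono hβ'β hβ
    have hzβ' : (β' : WithTop ℝ≥0) < swallowingTime W z := by rw [hb]; exact_mod_cast hβ'b
    have hsol := isSolution_imageFlowC_of_le hW hA hne hβ hβ'β hzH hzA hzβ'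
    -- the capacity time `q = σ t`
    set q : ℝ := imageClock W A t with hq
    have htI' : (t : ℝ) ∈ Icc (0 : ℝ) β' := ⟨t.coe_nonneg, (NNReal.coe_lt_coe.2 htβ').le⟩
    have htI : (t : ℝ) ∈ Icc (0 : ℝ) β := ⟨t.coe_nonneg, NNReal.coe_le_coe.2 (htβ'.le.trans hβ'β)⟩
    have hq0 : 0 ≤ q := (imageClock_mem hW hA hne hβ htI).1
    have hqβ' : q < imageClock W A β' :=
      hmonoβ htI ⟨β'.coe_nonneg, NNReal.coe_le_coe.2 hβ'β⟩ (NNReal.coe_lt_coe.2 htβ')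
    have hqb : q ≤ imageClock W A b :=
      hmonoβ.monotoneOn htI ⟨b.coe_nonneg, NNReal.coe_le_coe.2 hbβ⟩ htb'.le
    have hqβ : q ≤ imageClock W A β :=
      hmonoβ.monotoneOn htI ⟨β.coe_nonneg, le_rfl⟩ (NNReal.coe_le_coe.2 (htβ'.le.trans hβ'β))
    -- `ĝ q = imageFlowC W A β' z q = G_t z`
    have hS0' : 0 ≤ imageClock W A β' := (imageClock_mem hW hA hne hβ'al ⟨β'.coe_nonneg, le_rfl⟩).1
    have hqmem : q ∈ {s : ℝ | 0 ≤ s ∧ (s.toNNReal : WithTop ℝ≥0) <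
        min (swallowingTime Wc ζ) ((imageClock W A β').toNNReal : WithTop ℝ≥0)} := by
      refine ⟨hq0, lt_min (lt_of_le_of_lt ?_ hgt) ?_⟩
      · exact WithTop.coe_le_coe.2 (Real.toNNReal_le_toNNReal hqb)
      · exact WithTop.coe_lt_coe.2 ((Real.toNNReal_lt_toNNReal_iff (hq0.trans_lt hqβ')).2 hqβ')
    have heq := IsSolution.eqOn_holds hWcc hĝ hsol hqmem
    have hGt : imageFlowC W A β' z q = imageFlow W A t z := by
      rw [imageFlowC, hq, imageClockInv_imageClock hW hA hne hβ'al htI', Real.toNNReal_coe]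
    have hWt : (Wc q.toNNReal : ℂ) = imageDriver W A t := by
      rw [hWc, imageDriverC_toNNReal ⟨hq0, hqβ⟩, hq, imageClockInv_imageClock hW hA hne hβ htI, Real.toNNReal_coe]
    have h := hsep q ⟨hq0, hqb⟩
    rwa [heq, hGt, hWt] at h
  -- but the flow of `z` comes arbitrarily close to the driver before `b`
  set ε₀ : ℝ := min (4 * ρ) (δ / 2) with hε₀
  have hε₀0 : 0 < ε₀ := lt_min (by positivity) (by positivity)
  obtain ⟨r, -, hrb, hclose⟩ := exists_norm_map_sub_lt_of_swallowingTime_eq hW hb (s := 0) hb0 hε₀0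
  have hBr := isStarHull_slidHull_of_disjoint hW hA (alive_mono hrb.le hbal)
  have hy4 : ‖map W r z - W r‖ < 4 * ρ := hclose.trans_le (min_le_left _ _)
  have hyδ : ‖map W r z - W r‖ < δ / 2 := hclose.trans_le (min_le_right _ _)
  have h1 := norm_starMap_le_two_mul hBr hρ0 (hBρ r hrb.le) hy4
  have h2 := hfar r hrb
  rw [imageFlow_sub_imageDriver] at h2
  linarith

/-- **The swallowing times correspond under the clock**: a point `z ∈ ℍ ∖ A` swallowed at `b ≤ β`
(`β` an alive horizon) has image `g̃_0(ζ)` swallowed by the chain of `W̃ ∘ τ` exactly at `σ(b)`.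
[cite: LawlerSchrammWerner2003Restriction, §5 (g̃ a Loewner chain, its hulls Φ_A(K_t)); Lawler2005, Prop. 4.41] -/
theorem swallowingTime_imageDriverC_eq :
    swallowingTime (imageDriverC W A β) (imageFlow W A 0 z) = ((imageClock W A b).toNNReal : WithTop ℝ≥0) :=
  le_antisymm (swallowingTime_imageDriverC_le_imageClock hW hA hne hβ hzH hzA hb hbβ)
    (imageClock_le_swallowingTime_imageDriverC hW hA hne hβ hzH hzA hb hbβ)

end Lifetime

/-! ### The hulls of the image chain are the images of the hulls -/

section Hull

variable (hW : Continuous W) (hW0 : W 0 = 0) (hA : IsStarHull A) (hne : A.Nonempty) {β : ℝ≥0}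
  (hβ : Disjoint (closedHull W β) A)
include hW hW0 hA hne hβ

/-- **`Loewner.hull (W̃ ∘ τ) q = E_A(K_{τ q})`** for capacity times `q < σ β` ([LSW] §5: "`K̃_t = Φ_A(K_t)`";
`W 0 = 0`, so that `g̃_0 = E_A = Φ_A` on `ℍ ∖ A`): a point `ζ = Φ_A(z')` of `ℍ` is swallowed by the
image chain by time `q` iff `z'` is swallowed by the chain of `W` by time `τ q` (lifetime
correspondence `swallowingTime_imageDriverC_eq`, and survival past `σ β` of the images of points alive
at `β`, `le_swallowingTime_imageDriverC`). [cite: LawlerSchrammWerner2003Restriction, §5 (K̃_t = Φ_A(K_t)); Lawler2005, Prop. 4.41] -/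
theorem hull_imageDriverC_eq {q : ℝ≥0} (hq : (q : ℝ) < imageClock W A β) :
    hull (imageDriverC W A β) q = starMap A '' hull W (imageClockInv W A β q).toNNReal := by
  have hΦ := isRestrictionMap_starRMap hA
  have hS0 : 0 ≤ imageClock W A β := (imageClock_mem hW hA hne hβ ⟨β.coe_nonneg, le_rfl⟩).1
  have hqI : (q : ℝ) ∈ Icc (0 : ℝ) (imageClock W A β) := ⟨q.coe_nonneg, hq.le⟩
  obtain ⟨hτI, hστ⟩ := imageClockInv_spec hW hA hne hβ hqI
  set t : ℝ := imageClockInv W A β q with ht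
  have htβ : t.toNNReal ≤ β := by rw [← NNReal.coe_le_coe, Real.coe_toNNReal _ hτI.1]; exact hτI.2
  have htal : Disjoint (closedHull W t.toNNReal) A := alive_mono htβ hβ
  have hmono := strictMonoOn_imageClock hW hA hne hβ
  -- `g̃_0 = E_A` and `E_A = Φ_A` on `ℍ ∖ A`
  have hflow0 : ∀ {w : ℂ}, w ≠ 0 → imageFlow W A 0 w = starMap A w := fun hw ↦ imageFlow_zero hW hW0 hA hw
  have hEA : ∀ {w : ℂ}, w ∈ upperHalfPlaneSet \ A → starMap A w = starRMap A hA w := fun hw ↦ by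
    rw [starMap_eq hA, hullExt_of_mem_diff hw]
  -- points of `ℍ` off `A` have finite or infinite swallowing time; those in a hull at an alive time are off `A`
  have hoffA : ∀ {w : ℂ} {s : ℝ≥0}, Disjoint (closedHull W s) A → w ∈ hull W s → w ∉ A := fun hs hw hwA ↦
    Set.disjoint_left.1 hs (hull_subset_closedHull W _ hw) hwA
  ext ζ
  constructor
  · rintro ⟨hζH, hζT⟩
    -- `ζ = Φ_A z'` with `z' ∈ ℍ ∖ A`
    set z' : ℂ := (starRMap A hA).symm ζ with hz'
    have hz'mem : z' ∈ upperHalfPlaneSet \ A := (starRMap A hA).symm_mapsTo hζH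
    have hζeq : ζ = starMap A z' := by rw [hEA hz'mem, hz', (starRMap A hA).apply_symm_apply hζH]
    have hz'0 : z' ≠ 0 := fun h ↦ hA.2 (by
      have := hz'mem.1; rw [h] at this; exact absurd this (by simp [upperHalfPlaneSet]))
    refine ⟨z', ⟨hz'mem.1, ?_⟩, hζeq.symm⟩
    -- `T_{z'} ≤ τ q`, else the image of `z'` would survive past `q`
    by_contra hgt
    rw [not_le] at hgt
    have hζ' : ζ = imageFlow W A 0 z' := by rw [hflow0 hz'0]; exact hζeq
    rw [hζ'] at hζT
    rcases le_or_gt (swallowingTime W z') (β : WithTop ℝ≥0) with hle | hβlt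
    · -- swallowed at a time `b' ∈ (τ q, β]`
      obtain ⟨b', hb'⟩ := WithTop.ne_top_iff_exists.1 (ne_top_of_le_ne_top WithTop.coe_ne_top hle)
      have hb'eq : swallowingTime W z' = b' := hb'.symm
      have hb'β : b' ≤ β := by rw [hb'eq] at hle; exact WithTop.coe_le_coe.1 hle
      have hT := swallowingTime_imageDriverC_eq hW hA hne hβ hz'mem.1 hz'mem.2 hb'eq hb'β
      rw [hT] at hζT
      have h1 : imageClock W A b' ≤ q := by
        have := WithTop.coe_le_coe.1 hζT
        rwa [← NNReal.coe_le_coe, Real.coe_toNNReal _ ((imageClock_mem hW hA hne hβ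
          ⟨b'.coe_nonneg, NNReal.coe_le_coe.2 hb'β⟩).1)] at this
      have h2 : (t.toNNReal : ℝ) < b' := by
        have := hgt; rw [hb'eq] at this; exact_mod_cast WithTop.coe_lt_coe.1 this
      rw [Real.coe_toNNReal _ hτI.1] at h2
      have h3 := hmono hτI ⟨b'.coe_nonneg, NNReal.coe_le_coe.2 hb'β⟩ h2
      rw [hστ] at h3
      linarith
    · -- alive at `β`: the image survives past `σ β > q`
      have hT := le_swallowingTime_imageDriverC hW hA hne hβ hz'mem.1 hz'mem.2 hβlt
      have h1 := (hT.trans hζT)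
      have : imageClock W A β ≤ q := by
        have := WithTop.coe_le_coe.1 h1
        rwa [← NNReal.coe_le_coe, Real.coe_toNNReal _ hS0] at this
      linarith
  · rintro ⟨z', ⟨hz'H, hz'T⟩, rfl⟩
    have hz'A : z' ∉ A := hoffA htal ⟨hz'H, hz'T⟩
    have hz'mem : z' ∈ upperHalfPlaneSet \ A := ⟨hz'H, hz'A⟩
    have hz'0 : z' ≠ 0 := fun h ↦ by rw [h] at hz'H; exact absurd hz'H (by simp [upperHalfPlaneSet])
    refine ⟨?_, ?_⟩
    · rw [hEA hz'mem]; exact (starRMap A hA).mapsTo hz'mem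
    · -- swallowed at `b' ≤ τ q`, so the image is swallowed at `σ b' ≤ q`
      obtain ⟨b', hb'⟩ := WithTop.ne_top_iff_exists.1 (ne_top_of_le_ne_top WithTop.coe_ne_top hz'T)
      have hb'eq : swallowingTime W z' = b' := hb'.symm
      have hb't : b' ≤ t.toNNReal := by rw [hb'eq] at hz'T; exact WithTop.coe_le_coe.1 hz'T
      have hb'β : b' ≤ β := hb't.trans htβ
      have hT := swallowingTime_imageDriverC_eq hW hA hne hβ hz'H hz'A hb'eq hb'β
      rw [← hflow0 hz'0, hT]
      refine WithTop.coe_le_coe.2 ?_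
      rw [← NNReal.coe_le_coe, Real.coe_toNNReal _ ((imageClock_mem hW hA hne hβ ⟨b'.coe_nonneg, NNReal.coe_le_coe.2 hb'β⟩).1)]
      have h1 : (b' : ℝ) ≤ t := by
        have := NNReal.coe_le_coe.2 hb't; rwa [Real.coe_toNNReal _ hτI.1] at this
      have := hmono.monotoneOn ⟨b'.coe_nonneg, NNReal.coe_le_coe.2 hb'β⟩ hτI h1
      rwa [hστ] at this

end Hull

end Loewner

end Literature.Probability.RandomPlanarGeometry

end
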